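import Summits.QuantumFields.YangMills.Theorems.UnitScaleTiltProp7PinnedBiharmonicAgmonDecay
import HarnessLib

/-!
# Route `UnitScaleTilt`, crux K1 «MinimiserStabilityRegPr» (stmt-QuantumFields-19200), route-R E′ path (α′), residue (hK), assembly (A), row (EL-loc):
# THE LOCALISED EULER–LAGRANGE IDENTITY OF THE PEELED KERNEL — the pinned interpolation error of `(1 − χ)·V` (`Δ²V = f`, `χ ≡ 1` on `supp f`)
# solves the three-source EL identity of ✓ `…PinnedBiharmonicAgmonDecay.weighted_laplace_le_core` with sources built from the COMMUTATOR
# `[Δ, χ]` only: `h = −[Δ,χ]V` (type 1), `h̃(b) = −g(b₋)·∂χ(b)` (type 1.5), `s(x) = Σ_μ ∂χ·∂g` (type 3), `g := ΔV` — all supported where `χ` is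
# not locally constant; the non-local tail `(1 − χ)·g` of `Δ((1 − χ)V)` never enters

Cell `ym3-torus`, width seat `ym3-torus-px22` (gen 2), on ★routeR-w3 g5's «px22: (A3) FAR-FIELD LOCATE» 2026-08-28T19:28:35Z; LOCATE 19200 evidence
`LOCATE-A3-FARFIELD-px22g2.md` §3.  `--supports stmt-QuantumFields-19200`, count-neutral.  THEOREMS ONLY (0 `def`, 0 `sorry`).  YM₃ on T³ is a
ladder rung (R3), not the Clay problem; nothing here claims the stub, the crux, d = 4 or the gap.

THE POINT.  (hK) `Σ_z|K(b,z)| ≤ c_I·ℓ` for `K(b,·) = c·ΔE[V]` (`V = Δ⁻²(δ_{b₊} − δ_{b₋})`, `E[F] = F − F_H` the pinned-biharmonic interpolation error)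
is assembled as `E[V] = E[(1−χ₀)V] + (χ₀V − u) + E[u]` (LOCATE §2).  For the screened remainder `e = E[(1−χ₀)V]` the energy door ✓ `weighted_laplace_le_core`
wants the EL identity `Σ(Δe)(Δv) = Σ h·Δv + Σ_b h̃·∂v + Σ s·v` with sources one can put under an exponential weight.  What the EL functional sees is
`Δ²((1−χ)V)` OFF the pins, and `Δ²((1−χ)V) = −[Δ,χ]g − Δ([Δ,χ]V)` as soon as `(1−χ)f = 0`: this file proves exactly that bookkeeping, abstractly in
`(V, g, f, χ)`, plus the pointwise commutator identities∕bound the assembly uses for the sizes.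

WHAT IS PROVED (ns `…Theorems.Prop7PinnedPeelingEL`; torus `T^{(j)}`, lattice factor `c`, real site fields; `[Δ,χ]F(x) := Δ(χF)(x) − χ(x)ΔF(x)`).
* §1 `laplace_mul_sub_mul_laplace` (`[Δ,χ]F(x) = Σ_μ c²[(χ(x)−χ(x+μ))F(x+μ) + (χ(x)−χ(x−μ))F(x−μ)]`), `laplace_mul_sub_mul_laplace'` (gradient∕Laplacian
  form), `laplace_mul_sub_mul_laplace_eq_zero` (vanishes where `χ` is locally constant), ★ `abs_laplace_mul_sub_mul_laplace_le`
  (`|[Δ,χ]F(x)| ≤ d·c²·(C₁D₁ + C₂D₀)` from `|χ(x+μ)−χ(x)| ≤ C₁`, `|χ(x+μ)+χ(x−μ)−2χ(x)| ≤ C₂`, `|F(x+μ)−F(x−μ)| ≤ D₁`, `|F(x−μ)| ≤ D₀`),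
  `laplace_one_sub_mul` (`Δ((1−χ)V) = ΔV − Δ(χV)`).
* §2 ★★ `sum_comm_laplace_mul` — THE COMMUTATOR AGAINST A TEST FUNCTION IS A BOND SOURCE PLUS A SITE SOURCE:
  `Σ_x [Δ,χ]g(x)·v(x) = Σ_b g(b₋)·∂χ(b)·∂v(b) − Σ_b ∂χ(b)·∂g(b)·v(b₋)`.
* §3 ★★★ `el_of_peeled` — for `ΔV = g`, `Δg = f`, `(1−χ)·f = 0`, and `φ_H` biharmonic off `C`: for every `v` vanishing on `C`,
  `Σ_x Δ((1−χ)V − φ_H)·Δv = Σ_x (χg − Δ(χV))·Δv + Σ_b (−g(b₋)∂χ(b))·∂v(b) + Σ_x (Σ_μ ∂χ(x,μ)∂g(x,μ))·v(x)` — the `hEL` row of ✓ `weighted_laplace_le_core`∕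
  `_window` with `h = χg − Δ(χV) = −[Δ,χ]V`, `ht = −g(b₋)∂χ`, `s = Σ_μ ∂χ∂g`; `h_eq_neg_comm`, `h_eq_zero_of_locally_const`, `ht_eq_zero_of_eq`,
  `s_eq_zero_of_locally_const` record the supports.
HONEST SCOPE.  Algebra only (summation by parts on the torus); no estimate of `V`, `g`, no weight, no Poincaré row — those are the assembly's ((A3-sum),
LOCATE §3–§4, inputs (R2)(R3a)(Hess3)(R4)(R5)(W1)(W2)(D1-glob)).  Flat letters only.

References: T. Bałaban, CMP 95 (1984) 17–40 [Balaban1984PropagatorsI] ((1.21) p.21, Sect. C p.22); CMP 96 (1984) 223–250 [Balaban1984PropagatorsII] ((1.9) p.226);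
CMP 102 (1985) 277–309 [Balaban1985Variational] (Prop. 7 p.299).
-/

set_option autoImplicit false

noncomputable section

open scoped BigOperators

namespace Summit.QuantumFields.YangMills.Theorems.Prop7PinnedPeelingEL

open Literature.MathematicalPhysics.QuantumFieldTheory.Balaban1983to89
open Finset LatticeFieldCalculus
open B10StarCount (sum_pbond shift_unshift unshift_shift)
open Summit.QuantumFields.YangMills.Theorems.Prop7CentreHarmonicInterpKernel (sum_comp_shift sum_comp_unshift' laplace_sub')
open Summit.QuantumFields.YangMills.Theorems.Prop7PinnedHodgeSplit (sum_mul_laplace_comm)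
open Summit.QuantumFields.YangMills.Theorems.Prop7PinnedBiharmonicAgmonDecay (el_of_biharmonic_off)

variable {P : Params} {j : ℕ}

/-! ## §1 The commutator `[Δ, χ]` pointwise -/

/-- **`[Δ,χ]F(x) = Σ_μ c²[(χ(x)−χ(x+e_μ))F(x+e_μ) + (χ(x)−χ(x−e_μ))F(x−e_μ)]`.** [cite: Balaban1984PropagatorsI, (1.21) p.21] -/
theorem laplace_mul_sub_mul_laplace (c : ℝ) (χ F : SiteField P j ℝ) (x : Site P j) :
    laplace c (fun y => χ y * F y) x - χ x * laplace c F x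
      = ∑ μ : Fin P.d, c ^ 2 * ((χ x - χ (x.shift μ)) * F (x.shift μ) + (χ x - χ (x.unshift μ)) * F (x.unshift μ)) := by
  simp only [laplace, smul_eq_mul, Finset.mul_sum, ← Finset.sum_sub_distrib]
  refine Finset.sum_congr rfl fun μ _ => ?_
  ring

/-- **Gradient∕Laplacian form**: `[Δ,χ]F(x) = Σ_μ c²[(χ(x)−χ(x+e_μ))(F(x+e_μ)−F(x−e_μ)) − (χ(x+e_μ)+χ(x−e_μ)−2χ(x))F(x−e_μ)]` — one difference of `χ` against one
difference of `F`, plus the second difference of `χ` against `F`. [cite: Balaban1984PropagatorsI, (1.21) p.21] -/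
theorem laplace_mul_sub_mul_laplace' (c : ℝ) (χ F : SiteField P j ℝ) (x : Site P j) :
    laplace c (fun y => χ y * F y) x - χ x * laplace c F x
      = ∑ μ : Fin P.d, c ^ 2 * ((χ x - χ (x.shift μ)) * (F (x.shift μ) - F (x.unshift μ))
          - (χ (x.shift μ) + χ (x.unshift μ) - 2 * χ x) * F (x.unshift μ)) := by
  rw [laplace_mul_sub_mul_laplace]
  refine Finset.sum_congr rfl fun μ _ => ?_
  ring

/-- **`[Δ,χ]F(x) = 0` where `χ` is locally constant** (equal at `x` and its `2d` neighbours). [cite: Balaban1984PropagatorsI, (1.21) p.21] -/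
theorem laplace_mul_sub_mul_laplace_eq_zero (c : ℝ) (χ F : SiteField P j ℝ) (x : Site P j)
    (h : ∀ μ, χ (x.shift μ) = χ x ∧ χ (x.unshift μ) = χ x) :
    laplace c (fun y => χ y * F y) x - χ x * laplace c F x = 0 := by
  rw [laplace_mul_sub_mul_laplace]
  refine Finset.sum_eq_zero fun μ _ => ?_
  rw [(h μ).1, (h μ).2]
  ring

/-- ★ **POINTWISE BOUND**: `|[Δ,χ]F(x)| ≤ d·c²·(C₁D₁ + C₂D₀)` from the first∕second difference sizes of `χ` at `x` and the symmetric difference ∕ size of `F`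
around `x`. [cite: Balaban1984PropagatorsII, (1.9) p.226] -/
theorem abs_laplace_mul_sub_mul_laplace_le (c : ℝ) (χ F : SiteField P j ℝ) (x : Site P j) {C₁ C₂ D₀ D₁ : ℝ}
    (hχ₁ : ∀ μ, |χ (x.shift μ) - χ x| ≤ C₁)
    (hχ₂ : ∀ μ, |χ (x.shift μ) + χ (x.unshift μ) - 2 * χ x| ≤ C₂)
    (hF₁ : ∀ μ, |F (x.shift μ) - F (x.unshift μ)| ≤ D₁)
    (hF₀ : ∀ μ, |F (x.unshift μ)| ≤ D₀) :
    |laplace c (fun y => χ y * F y) x - χ x * laplace c F x| ≤ P.d * (c ^ 2 * (C₁ * D₁ + C₂ * D₀)) := by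
  rw [laplace_mul_sub_mul_laplace']
  calc |∑ μ : Fin P.d, c ^ 2 * ((χ x - χ (x.shift μ)) * (F (x.shift μ) - F (x.unshift μ))
          - (χ (x.shift μ) + χ (x.unshift μ) - 2 * χ x) * F (x.unshift μ))|
      ≤ ∑ μ : Fin P.d, |c ^ 2 * ((χ x - χ (x.shift μ)) * (F (x.shift μ) - F (x.unshift μ))
          - (χ (x.shift μ) + χ (x.unshift μ) - 2 * χ x) * F (x.unshift μ))| := Finset.abs_sum_le_sum_abs _ _
    _ ≤ ∑ _μ : Fin P.d, c ^ 2 * (C₁ * D₁ + C₂ * D₀) := by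
        refine Finset.sum_le_sum fun μ _ => ?_
        rw [abs_mul, abs_of_nonneg (sq_nonneg c)]
        refine mul_le_mul_of_nonneg_left ?_ (sq_nonneg c)
        have hC₁ : 0 ≤ C₁ := (abs_nonneg _).trans (hχ₁ μ)
        have hC₂ : 0 ≤ C₂ := (abs_nonneg _).trans (hχ₂ μ)
        have h1 : |(χ x - χ (x.shift μ)) * (F (x.shift μ) - F (x.unshift μ))| ≤ C₁ * D₁ := by
          rw [abs_mul, abs_sub_comm]
          exact mul_le_mul (hχ₁ μ) (hF₁ μ) (abs_nonneg _) hC₁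
        have h2 : |(χ (x.shift μ) + χ (x.unshift μ) - 2 * χ x) * F (x.unshift μ)| ≤ C₂ * D₀ := by
          rw [abs_mul]
          exact mul_le_mul (hχ₂ μ) (hF₀ μ) (abs_nonneg _) hC₂
        exact (abs_sub _ _).trans (add_le_add h1 h2)
    _ = P.d * (c ^ 2 * (C₁ * D₁ + C₂ * D₀)) := by
        rw [Finset.sum_const, Finset.card_univ, Fintype.card_fin, nsmul_eq_mul]

/-- `Δ((1−χ)V) = ΔV − Δ(χV)` pointwise (linearity). [cite: Balaban1984PropagatorsI, (1.21) p.21] -/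
theorem laplace_one_sub_mul (c : ℝ) (χ V : SiteField P j ℝ) (x : Site P j) :
    laplace c (fun y => (1 - χ y) * V y) x = laplace c V x - laplace c (fun y => χ y * V y) x := by
  have e : (fun y => (1 - χ y) * V y) = fun y => V y - χ y * V y := funext fun y => by ring
  rw [e, laplace_sub']

/-! ## §2 ★★ The commutator against a test function: a bond source plus a site source -/

/-- ★★ **`Σ_x [Δ,χ]g(x)·v(x) = Σ_b g(b₋)·∂χ(b)·∂v(b) − Σ_b ∂χ(b)·∂g(b)·v(b₋)`** (one summation by parts on the torus per direction: the
backward piece is reindexed by `x ↦ x + e_μ`). [cite: Balaban1984PropagatorsI, (1.21) p.21] -/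
theorem sum_comm_laplace_mul (c : ℝ) (χ g v : SiteField P j ℝ) :
    ∑ x, (laplace c (fun y => χ y * g y) x - χ x * laplace c g x) * v x
      = ∑ b : PBond P j, (g b.src * grad c χ b) * grad c v b - ∑ b : PBond P j, (grad c χ b * grad c g b) * v b.src := by
  rw [sum_pbond, sum_pbond, ← Finset.sum_sub_distrib]
  simp only [laplace_mul_sub_mul_laplace, Finset.sum_mul, ← Finset.sum_sub_distrib]
  rw [Finset.sum_comm]
  conv_rhs => rw [Finset.sum_comm]
  refine Finset.sum_congr rfl fun μ _ => ?_
  -- per direction `μ`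
  have h1 : ∑ x : Site P j, c ^ 2 * ((χ x - χ (x.unshift μ)) * g (x.unshift μ)) * v x
      = ∑ x : Site P j, c ^ 2 * ((χ (x.shift μ) - χ x) * g x) * v (x.shift μ) := by
    rw [← sum_comp_shift μ (fun x => c ^ 2 * ((χ x - χ (x.unshift μ)) * g (x.unshift μ)) * v x)]
    simp only [unshift_shift]
  have e1 : ∀ x : Site P j, c ^ 2 * ((χ x - χ (x.shift μ)) * g (x.shift μ) + (χ x - χ (x.unshift μ)) * g (x.unshift μ)) * v x
      = c ^ 2 * ((χ x - χ (x.shift μ)) * g (x.shift μ)) * v x + c ^ 2 * ((χ x - χ (x.unshift μ)) * g (x.unshift μ)) * v x :=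
    fun x => by ring
  rw [Finset.sum_congr rfl fun x _ => e1 x, Finset.sum_add_distrib, h1, ← Finset.sum_add_distrib]
  refine Finset.sum_congr rfl fun x _ => ?_
  simp only [grad, PBond.tgt, smul_eq_mul]
  ring

/-! ## §3 ★★★ The Euler–Lagrange identity of the peeled kernel -/

/-- `χ·g − Δ(χV) = −[Δ,χ]V` when `ΔV = g`. [cite: Balaban1984PropagatorsI, (1.21) p.21] -/
theorem h_eq_neg_comm (c : ℝ) (χ V g : SiteField P j ℝ) (hg : laplace c V = g) (x : Site P j) :
    χ x * g x - laplace c (fun y => χ y * V y) x = -(laplace c (fun y => χ y * V y) x - χ x * laplace c V x) := by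
  rw [← hg]
  ring

/-- the type-1 source vanishes where `χ` is locally constant. [cite: Balaban1984PropagatorsI, (1.21) p.21] -/
theorem h_eq_zero_of_locally_const (c : ℝ) (χ V g : SiteField P j ℝ) (hg : laplace c V = g) (x : Site P j)
    (h : ∀ μ, χ (x.shift μ) = χ x ∧ χ (x.unshift μ) = χ x) :
    χ x * g x - laplace c (fun y => χ y * V y) x = 0 := by
  rw [h_eq_neg_comm c χ V g hg, laplace_mul_sub_mul_laplace_eq_zero c χ V x h, neg_zero]

/-- the type-1.5 (bond) source vanishes on bonds along which `χ` is constant. [folklore] -/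
theorem ht_eq_zero_of_eq (c : ℝ) (χ g : SiteField P j ℝ) (b : PBond P j) (h : χ b.tgt = χ b.src) :
    -(g b.src * grad c χ b) = 0 := by
  simp [grad, h]

/-- the type-3 (site) source vanishes where `χ` is constant on the forward bonds at `x`. [folklore] -/
theorem s_eq_zero_of_locally_const (c : ℝ) (χ g : SiteField P j ℝ) (x : Site P j) (h : ∀ μ, χ (x.shift μ) = χ x) :
    ∑ μ : Fin P.d, grad c χ ⟨x, μ⟩ * grad c g ⟨x, μ⟩ = 0 := by
  refine Finset.sum_eq_zero fun μ _ => ?_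
  simp [grad, PBond.tgt, h μ]

/-- ★★★ **THE LOCALISED EULER–LAGRANGE IDENTITY OF THE PEELED KERNEL.**  Let `ΔV = g`, `Δg = f`, let the cutoff `χ` equal `1` on the support of `f`
(`(1−χ)f = 0`), and let `φ_H` be biharmonic off `C` (`Δ²φ_H = 0` off `C`; e.g. a pinned interpolant of `((1−χ)V)|_C`).  Then for every `v` vanishing on `C`
`Σ_x Δ((1−χ)V − φ_H)·Δv = Σ_x (χg − Δ(χV))·Δv + Σ_b (−g(b₋)∂χ(b))·∂v(b) + Σ_x (Σ_μ ∂χ(x,μ)∂g(x,μ))·v(x)` — the row `hEL` of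
✓ `Prop7PinnedBiharmonicAgmonDecay.weighted_laplace_le_core` with `h = χg − Δ(χV)` (`= −[Δ,χ]V`), `ht(b) = −g(b₋)∂χ(b)`, `s = Σ_μ ∂χ∂g`, ALL SUPPORTED
WHERE `χ` IS NOT LOCALLY CONSTANT (`h_eq_zero_of_locally_const`, `ht_eq_zero_of_eq`, `s_eq_zero_of_locally_const`): the non-local tail `(1−χ)g` of
`Δ((1−χ)V)` cancels against `Δg = f = χf`. [cite: Balaban1984PropagatorsII, (1.9) p.226; Balaban1985Variational, Prop. 7 p.299] -/
theorem el_of_peeled (c : ℝ) (C : Set (Site P j)) (χ V g f φH : SiteField P j ℝ)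
    (hg : laplace c V = g) (hf : laplace c g = f) (hχf : ∀ x, (1 - χ x) * f x = 0)
    (hEL : ∀ x ∉ C, laplace c (laplace c φH) x = 0) (v : SiteField P j ℝ) (hv : ∀ y ∈ C, v y = 0) :
    ∑ x, laplace c (fun y => (1 - χ y) * V y - φH y) x * laplace c v x
      = ∑ x, (χ x * g x - laplace c (fun y => χ y * V y) x) * laplace c v x
        + ∑ b : PBond P j, (-(g b.src * grad c χ b)) * grad c v b
        + ∑ x, (∑ μ : Fin P.d, grad c χ ⟨x, μ⟩ * grad c g ⟨x, μ⟩) * v x := by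
  -- move `Δ` off `φ_H`
  have h0 := el_of_biharmonic_off c C (fun y => (1 - χ y) * V y) φH hEL v hv
  simp only [zero_mul, Finset.sum_const_zero, add_zero] at h0
  rw [h0]
  -- `Δ((1−χ)V) = (χg − Δ(χV)) + (1−χ)g`
  have h1 : ∀ x, laplace c (fun y => (1 - χ y) * V y) x
      = (χ x * g x - laplace c (fun y => χ y * V y) x) + (1 - χ x) * g x := by
    intro x
    rw [laplace_one_sub_mul, ← hg]
    ring
  simp only [h1, add_mul, Finset.sum_add_distrib]
  -- the tail: `Σ (1−χ)g·Δv = Σ Δ((1−χ)g)·v = −Σ [Δ,χ]g·v` since `Δg = f = χf`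
  have h2 : ∑ x, (1 - χ x) * g x * laplace c v x
      = -∑ x, (laplace c (fun y => χ y * g y) x - χ x * laplace c g x) * v x := by
    rw [sum_mul_laplace_comm c (fun x => (1 - χ x) * g x) v, ← Finset.sum_neg_distrib]
    refine Finset.sum_congr rfl fun x _ => ?_
    rw [laplace_one_sub_mul, hf]
    have := hχf x
    have e : laplace c (fun y => χ y * g y) x - χ x * f x = laplace c (fun y => χ y * g y) x - f x + (1 - χ x) * f x := by ring
    rw [e, this, add_zero]
    ring
  rw [h2, sum_comm_laplace_mul]
  have e3 : ∑ b : PBond P j, (-(g b.src * grad c χ b)) * grad c v b = -∑ b : PBond P j, (g b.src * grad c χ b) * grad c v b := by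
    rw [← Finset.sum_neg_distrib]
    exact Finset.sum_congr rfl fun b _ => by ring
  have e4 : ∑ x, (∑ μ : Fin P.d, grad c χ ⟨x, μ⟩ * grad c g ⟨x, μ⟩) * v x
      = ∑ b : PBond P j, (grad c χ b * grad c g b) * v b.src := by
    rw [sum_pbond]
    exact Finset.sum_congr rfl fun x _ => by rw [Finset.sum_mul]
  rw [e3, e4]
  ring

end Summit.QuantumFields.YangMills.Theorems.Prop7PinnedPeelingEL

end
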